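import Summits.KontsevichZagierPeriods.KontsevichZagierPeriods.Theorems.LiouvilleUnfoldingAyoubPiCancellationStubStripConst

/-!
# Crux stmt-KontsevichZagierPeriods-0540 (`LiouvilleUnfolding.AyoubPiCancellation` ≡ `KZ.PiCancellation`),
# line `Sketch` (idea `moving-segment-wronskian`): stub `stub_spreadSegmentConst`

Support file (`--supports` stmt-KontsevichZagierPeriods-0540) of the line skeleton (v6), registered
stub `stub_spreadSegmentConst` (S). The SEGMENT STAGE of the weighted spread solid of an interval
`a' < b'` (`a' b'` rational), `K_mid = [[a', b'], −(x − a')(x − b')]` (dimension `1`), is worth the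
rational constant `(b' − a')³/6` against every factor `s = [σ, f]`:
`s × K_mid ∼ [σ, ((b' − a')³/6)·f]` in the Kontsevich–Zagier calculus of `KZCalculus.lean`.

This is ONE Newton–Leibniz move (printed rule (3), dimension `m + 1 → m`) over the arbitrary base
`s = [σ, f]`: the band `σ × [a', b']` has the constant edges `a' ≤ b'`, the primitive is
`F = f ⊗ (−P)` with `P(t) = t³/3 − (a' + b') t²/2 + a' b' t` (the integrand of the product of `s`
with the auxiliary representation `[[a', b'], −P(x)]`, hence `ℚ`-semialgebraic on the band), its
fibre derivative is `f x · (−P'(t)) = f x · (−(t − a')(t − b'))`, the integrand of `s × K_mid`, and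
the boundary term is `f x · (P(a') − P(b')) = ((b' − a')³/6) · f x`.
Template: `stripConst_of_prod_sub_of_constMul_mem_newtonLeibnizRel`
(`Theorems/LiouvilleUnfoldingAyoubPiCancellationStubStripConst.lean`), kernel `𝟙_{(a,b)}` and
primitive `f ⊗ x` there, kernel `−(x − a')(x − b')` and primitive `f ⊗ (−P)` here. No definitions:
the move is stated for arbitrary representations with prescribed domains and integrands, which the
stub instantiates by an anonymous constructor.
References: M. Kontsevich, D. Zagier, *Periods* (2001), §1.1, §1.2 (rule (3)).
-/

noncomputable section

-- `Summit.KontsevichZagierPeriods.KontsevichZagierPeriods.…` is the tree's mandated layout (single-conjunct summit).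
set_option linter.dupNamespace false

namespace Summit.KontsevichZagierPeriods.KontsevichZagierPeriods.AyoubPiCancellationLine

open Set MeasureTheory
open Literature.NumberTheory.Transcendental
open Literature.NumberTheory.Transcendental.KZ
open Literature.ModelTheory.ExponentialFields (IsSemialgebraic)
open MvPolynomial (aeval X C)
open Summit.KontsevichZagierPeriods.KontsevichZagierPeriods.BetaCancellationNegative
  (natAdd_zero_eq_last init_eq_comp_castAdd)
open Summit.KontsevichZagierPeriods.KontsevichZagierPeriods.BetaCancellationLine
  (prod_integrand_snoc)
open Summit.KontsevichZagierPeriods.CompleteModGammaSectorNegative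
  (isSemialgebraic_band isCompact_band)

-- adapted from Summits/KontsevichZagierPeriods/KontsevichZagierPeriods/Theorems/LiouvilleUnfoldingAyoubPiCancellationStubStripConst.lean
-- (`stripConst_of_prod_sub_of_constMul_mem_newtonLeibnizRel`: one Newton–Leibniz move along the
-- last coordinate over an arbitrary base, with a cubic primitive in place of `f ⊗ x`)

/-- The cubic primitive: `d/dt (−(t³/3 − (a + b) t²/2 + a b t)) = −(t − a)(t − b)`. [folklore] -/
theorem spreadSegmentConst_hasDerivAt_prim (a b t : ℝ) :
    HasDerivAt (fun u : ℝ => -(u ^ 3 / 3 - (a + b) * u ^ 2 / 2 + a * b * u))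
      (-((t - a) * (t - b))) t := by
  have h3 : HasDerivAt (fun u : ℝ => u ^ 3) (3 * t ^ 2) t := by simpa using hasDerivAt_pow 3 t
  have h2 : HasDerivAt (fun u : ℝ => u ^ 2) (2 * t) t := by simpa using hasDerivAt_pow 2 t
  refine ((((h3.div_const 3).fun_sub ((h2.const_mul (a + b)).div_const 2)).fun_add
    ((hasDerivAt_id' t).const_mul (a * b))).fun_neg).congr_deriv ?_
  ring

/-- The boundary term of the cubic primitive `P(t) = t³/3 − (a + b) t²/2 + a b t`:
`P(a) − P(b) = (b − a)³/6`. [folklore] -/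
theorem spreadSegmentConst_boundary (a b f : ℝ) :
    (b - a) ^ 3 / 6 * f =
      f * -(b ^ 3 / 3 - (a + b) * b ^ 2 / 2 + a * b * b) -
        f * -(a ^ 3 / 3 - (a + b) * a ^ 2 / 2 + a * b * a) := by
  ring

/-- **`s × [[a', b'], −(x − a')(x − b')] − [σ, ((b' − a')³/6)·f]` is one Newton–Leibniz move** over
the arbitrary base `s = [σ, f]` (for any representations `K_mid = [[a', b'], −(x − a')(x − b')]`,
`Pc = [[a', b'], −(x³/3 − (a' + b') x²/2 + a' b' x)]` with these domains and integrands): constant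
edges `a' ≤ b'`, primitive `F = f ⊗ (−P)`, whose fibre derivative `f · (−(t − a')(t − b'))` is the
integrand of `s × K_mid`; boundary term `f · (−P(b')) − f · (−P(a')) = ((b' − a')³/6) · f`.
[cite: KontsevichZagier2001, §1.2 rule (3)] -/
theorem spreadSegmentConst_of_prod_sub_of_constMul_mem_newtonLeibnizRel {a' b' : ℚ}
    (hab : a' < b') {m : ℕ} (s : IntegralRep m) (Kmid Pc : IntegralRep 1)
    (hMd : Kmid.domain = {x : Fin 1 → ℝ | (a' : ℝ) ≤ x 0 ∧ x 0 ≤ b'})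
    (hMi : Kmid.integrand = fun x : Fin 1 → ℝ => -((x 0 - a') * (x 0 - b')))
    (hPd : Pc.domain = {x : Fin 1 → ℝ | (a' : ℝ) ≤ x 0 ∧ x 0 ≤ b'})
    (hPi : Pc.integrand = fun x : Fin 1 → ℝ =>
      -(x 0 ^ 3 / 3 - (a' + b') * x 0 ^ 2 / 2 + a' * b' * x 0))
    (hκ : IsAlgebraic ℚ (((b' - a') ^ 3 / 6 : ℚ) : ℝ)) :
    of (s.prod Kmid) - of (s.constMul (((b' - a') ^ 3 / 6 : ℚ) : ℝ) hκ) ∈ newtonLeibnizRel := by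
  have hdom : (s.prod Kmid).domain = (s.prod Pc).domain := by
    ext z
    simp only [IntegralRep.prod_domain, IntegralRep.mem_prodDomain, hMd, hPd]
  have hab' : (a' : ℝ) ≤ b' := by exact_mod_cast hab.le
  refine ⟨m, s.prod Kmid, s.constMul (((b' - a') ^ 3 / 6 : ℚ) : ℝ) hκ, fun _ => (a' : ℝ),
    fun _ => (b' : ℝ), (s.prod Pc).integrand, ?_, ?_, ?_, fun _ _ => hab', ?_, ?_, ?_, ?_, rfl⟩
  · -- `F = f ⊗ (−P)` is the integrand of a product representation, hence semialgebraic
    rw [hdom]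
    exact (s.prod Pc).isSemialgebraicFunOn_integrand
  · -- the edge `a'` is semialgebraic on `σ`
    exact (isSemialgebraicFunOn_aeval s.isSemialgebraic_domain
      (C a' : MvPolynomial (Fin m) ℚ)).congr fun x _ => by simp
  · -- the edge `b'` is semialgebraic on `σ`
    exact (isSemialgebraicFunOn_aeval s.isSemialgebraic_domain
      (C b' : MvPolynomial (Fin m) ℚ)).congr fun x _ => by simp
  · -- `σ × [a', b']` is the band with constant edges over `σ`
    ext z
    simp only [IntegralRep.prod_domain, IntegralRep.mem_prodDomain, hMd,
      IntegralRep.domain_constMul, mem_setOf_eq, init_eq_comp_castAdd, natAdd_zero_eq_last]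
  · -- continuity of `t ↦ f x · (−P(t))` on the closed fibre
    intro x _
    simp only [prod_integrand_snoc, hPi]
    fun_prop
  · -- `∂/∂t (f x · (−P(t))) = f x · (−(t − a')(t − b'))` on the open fibre
    intro x _ t _
    have hF : (fun t : ℝ => (s.prod Pc).integrand (Fin.snoc x t)) =
        fun t => s.integrand x * -(t ^ 3 / 3 - ((a' : ℝ) + b') * t ^ 2 / 2 + (a' : ℝ) * b' * t) := by
      funext t
      simp only [prod_integrand_snoc, hPi]
    have hk : (s.prod Kmid).integrand (Fin.snoc x t) =
        s.integrand x * -((t - a') * (t - b')) := by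
      simp only [prod_integrand_snoc, hMi]
    rw [hF, hk]
    exact (spreadSegmentConst_hasDerivAt_prim (a' : ℝ) b' t).const_mul (s.integrand x)
  · -- the boundary term: `((b' − a')³/6) f x = f x · (−P(b')) − f x · (−P(a'))`
    intro x _
    simp only [prod_integrand_snoc, hPi, IntegralRep.integrand_constMul]
    push_cast
    exact spreadSegmentConst_boundary (a' : ℝ) b' (s.integrand x)

/-- **STUB `stub_spreadSegmentConst`** (S) of the line `Sketch` — **the segment stage is worth
`(b' − a')³/6` against every factor**: for every representation
`K_mid = [[a', b'], −(x − a')(x − b')]` (`a' < b'` rational) and every `s = [σ, f]`,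
`s × K_mid ∼ [σ, ((b' − a')³/6)·f]` — one Newton–Leibniz move over the base `s` with constant
edges `a' ≤ b'` and primitive `f ⊗ (−(x³/3 − (a' + b') x²/2 + a' b' x))`
(`∫_{a'}^{b'} −(x − a')(x − b') dx = (b' − a')³/6`). [folklore] -/
theorem stub_spreadSegmentConst : ∀ (a' b' : ℚ), a' < b' →
    ∀ (Kmid : IntegralRep 1), Kmid.domain = {x : Fin 1 → ℝ | ((a' : ℝ) ≤ x 0 ∧ x 0 ≤ b')} →
      (Kmid.integrand = fun x : Fin 1 → ℝ => -((x 0 - a') * (x 0 - b'))) →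
    ∀ (hκ : IsAlgebraic ℚ (((b' - a') ^ 3 / 6 : ℚ) : ℝ)) (m : ℕ) (s : IntegralRep m),
      Equivalent (s.prod Kmid) (s.constMul (((b' - a') ^ 3 / 6 : ℚ) : ℝ) hκ) := by
  intro a' b' hab Kmid hMd hMi hκ m s
  -- the auxiliary representation `Pc = [[a', b'], −P(x)]` carrying the primitive
  let Pc : IntegralRep 1 :=
    ⟨{x : Fin 1 → ℝ | (a' : ℝ) ≤ x 0 ∧ x 0 ≤ b'},
      fun x => -(x 0 ^ 3 / 3 - (a' + b') * x 0 ^ 2 / 2 + a' * b' * x 0),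
      isSemialgebraic_band a' b',
      (isSemialgebraicFunOn_aeval (isSemialgebraic_band a' b')
        (-(C (1 / 3 : ℚ) * X 0 ^ 3 - C ((a' + b') / 2) * X 0 ^ 2 + C (a' * b') * X 0) :
          MvPolynomial (Fin 1) ℚ)).congr fun x _ => by
            simp only [map_neg, map_add, map_sub, map_mul, map_pow, MvPolynomial.aeval_C,
              MvPolynomial.aeval_X, eq_ratCast]
            push_cast
            ring,
      (Continuous.continuousOn (by fun_prop)).integrableOn_compact (isCompact_band (a' : ℝ) b')⟩
  exact newtonLeibnizRel_subset_relations
    (spreadSegmentConst_of_prod_sub_of_constMul_mem_newtonLeibnizRel hab s Kmid Pc hMd hMi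
      rfl rfl hκ)

end Summit.KontsevichZagierPeriods.KontsevichZagierPeriods.AyoubPiCancellationLine
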